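import Mathlib
import Summits.QuantumFields.BalabanUV.Beta.AnalyticWalkSum216RowConstrainedDict

/-!
# [Balaban1985BackgroundPropagators] (3.186) p. 432 — JOINT SATISFIABILITY OF THE CONSTRAINED LAYER'S IDENTIFICATION
# WITH A GENUINE AVERAGING CONSTRAINT: two fine sites averaged to one coarse site, `K = 1`, `a = 1`; every hypothesis of
# `AnalyticWalkSum216RowConstrainedDict.termSum_constrainedΩ_flucCov_embed` (THEOREM B level, the dictionary discharged
# by the coordinate embedding) is met on explicit data, and the chain's sum at `s ≡ 1` IS the fluctuation covariance
# `G̃₂ = ½·[[1, −1], [−1, 1]]` of the block (cell topic `Summits/QuantumFields/BalabanUV/Beta`; row-D4 NODE A.4, records)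

HONEST FRAMING (cell rule).  Discharging `BetaPertH` makes Bałaban's UV stability UNCONDITIONAL — a real constructive-QFT
result; NOT the continuum limit, NOT the Clay problem.  This module discharges NOTHING of `BetaPertH`.  [folklore]: a
NON-VACUITY CERTIFICATE.  The sibling witnesses in the tree (`AnalyticWalkSum216RowResolventOmega.Witness`, one site, `d ≡ 0`,
`P = Q = 1`) have NO constraint; the gen-38 hand-off asked for «a joint-satisfiability witness for
`termSum_constrainedΩ_flucCov`'s hdict + kkt nonsingularity (a genuine 2-site constraint)».  Here: fine index `Y = Fin 2`,
coarse index `μ = Fin 1` with representative `e₂ ↦ 0`, the AVERAGING constraint `Q̃ = (1 1)`, `K = 1`, `a = 1`, so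
`G₂ = (K + Q̃ᵀQ̃)⁻¹ = ⅓[[2, −1], [−1, 2]]`, `Q̃G₂Q̃ᵀ = ⅔` (nonsingular — b09's two inputs `hKa`, `hPr` hold), ONE coarse
piece `Kp = Eᵀ(Q̃G₂Q̃ᵀ − 1)E = diag(−⅓, 0)`, its local inverse `L = diag(3∕2, 1)` on the one block (`h ≡ 1`), trivial
pseudo-metric, `κ = 0`, `κ₁ = 1`; ALL ≈ 45 binders of the THEOREM B statement are discharged (`termSum_fam₂`) and the value
`flucCov 1 Q̃ = ½[[1, −1], [−1, 1]]` is computed from b09's `eq_3186_scalar` (`flucCov_two_site`): the kernel of the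
averaging map, as it must be.  Nothing of Bałaban's operators is instantiated; NO class change on any GAPS row; readiness
width 0 unchanged; NOT summit progress.  Unit `b2b-balaban-beta-an4-g39` (owner lineage of `BINDER-OWNERS.md` row D4);
`GAPS.md` C-an4-102.

CITATION HEADER (lean-in-tree rule).  [13] = T. Bałaban, *Propagators for lattice gauge theories in a background field*,
Commun. Math. Phys. **99**, 389–434 (1985) [Balaban1985BackgroundPropagators], p. 432 (3.186) (quoted in the siblings'
headers).  LOCATOR only; nothing printed is asserted.

WHAT IS CERTIFIED HERE (kernel, sorry-free; [folklore]).  §1 the data and its arithmetic (`M₂ = K + Q̃ᵀQ̃`, `M₂⁻¹`,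
`Q̃M₂⁻¹Q̃ᵀ = ⅔`, `det`s, `(1 + Kp)·L = 1`); §2 **`termSum_fam₂`** (every hypothesis of
`termSum_constrainedΩ_flucCov_embed` discharged on the data; conclusion `termSum fam₂ 1 = flucCov 1 Q̃`);
§3 **`flucCov_two_site`** (`flucCov 1 Q̃ = ½[[1, −1], [−1, 1]]`) and `termSum_fam₂_explicit`.
NOT CLAIMED.  Anything about Bałaban's lattices; any k-uniformity.  NOT summit progress.
PRIOR ART IN THE TREE (searched 2026-08-20): `AnalyticWalkSum216RowResolventOmega.Witness` (one site, unconstrained);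
`AnalyticWalkSum216RowConstrained` §3 (THEOREM A level, `P = Q = 1`); d4-p3 `UnitLatticeOmegaWitness` (their Ω-binders on
one site).  None has a constraint.
-/

namespace Summit.QuantumFields.BalabanUV.Beta.AnalyticWalkSum216RowConstrainedWitness

open Metric Set
open scoped Matrix
open Literature.MathematicalPhysics.QuantumFieldTheory.Balaban1983to89
open B13PerturbativeStep (WRS WeightHyp wrs)
open Literature.MathematicalPhysics.QuantumFieldTheory.Balaban1983to89.Beta.CompositionSingular (flucCov)
open Literature.MathematicalPhysics.QuantumFieldTheory.Balaban1983to89.B9SectECov (eq_3186_scalar)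
open Summit.QuantumFields.BalabanUV.Beta.AnalyticWalkSum216 (termSum majSum)
open Summit.QuantumFields.BalabanUV.Beta.AnalyticWalkSum216Recomb (recombTerm recombMaj RIdx)
open Summit.QuantumFields.BalabanUV.Beta.AnalyticWalkSum216RowResolvent
open Summit.QuantumFields.BalabanUV.Beta.AnalyticWalkSum216RowConstrainedDict
open Summit.QuantumFields.BalabanUV.Beta.UnitLatticeWalkInversion (Hd Pj Ptot)
open Summit.QuantumFields.BalabanUV.Beta.UnitLatticeOmegaTerms
open Summit.QuantumFields.BalabanUV.Beta.UnitLatticeOmegaTube (listLen listLen_nonneg decΩ)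
open Summit.QuantumFields.BalabanUV.Beta.UnitLatticeOmegaPaths
open Summit.QuantumFields.BalabanUV.Beta.UnitLatticeOmegaRowData

noncomputable section

/-! ## §1 The two-site data -/

/-- Trivial pseudo-metric on the two fine sites. [folklore] -/
def d₀ : Fin 2 → Fin 2 → ℝ := fun _ _ => 0

/-- The weight hypothesis at `κ = 0`. [folklore] -/
theorem hw₀ : WeightHyp (0 : ℝ) d₀ := ⟨le_rfl, fun _ => rfl, fun _ _ => le_rfl, fun _ _ _ => by simp [d₀]⟩

/-- THE AVERAGING CONSTRAINT of the two-site block: `Q̃ = (1 1)` (all-ones `1 × 2`). [folklore] -/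
def Qt : Matrix (Fin 1) (Fin 2) ℂ := Matrix.of fun _ _ => 1

/-- Entries of `Q̃`. [folklore] -/
@[simp] theorem Qt_apply (a : Fin 1) (y : Fin 2) : Qt a y = 1 := rfl

/-- `M₂ := K + a·Q̃ᵀQ̃` with `K = 1`, `a = 1`: `[[2, 1], [1, 2]]`. [folklore] -/
def M₂ : Matrix (Fin 2) (Fin 2) ℂ := !![2, 1; 1, 2]

/-- Its inverse `G₂ = ⅓[[2, −1], [−1, 2]]` (the a-regularised covariance of the block). [folklore] -/
def Ginv : Matrix (Fin 2) (Fin 2) ℂ := !![2 / 3, -1 / 3; -1 / 3, 2 / 3]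

/-- `1 + 1·Q̃ᵀQ̃ = M₂`. [folklore] -/
theorem one_add_eq_M₂ : (1 : Matrix (Fin 2) (Fin 2) ℂ) + (1 : ℂ) • (Qtᵀ * Qt) = M₂ := by
  ext i j
  fin_cases i <;> fin_cases j <;> norm_num [M₂, Matrix.mul_apply, Matrix.one_apply, Fin.sum_univ_one]

/-- `M₂·Ginv = 1`. [folklore] -/
theorem M₂_mul_Ginv : M₂ * Ginv = 1 := by
  ext i j
  fin_cases i <;> fin_cases j <;> norm_num [M₂, Ginv, Matrix.mul_apply, Fin.sum_univ_two]

/-- `M₂⁻¹ = Ginv`. [folklore] -/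
theorem M₂_inv : M₂⁻¹ = Ginv := Matrix.inv_eq_right_inv M₂_mul_Ginv

/-- `det M₂ = 3`. [folklore] -/
theorem det_M₂ : M₂.det = 3 := by
  rw [M₂, Matrix.det_fin_two_of]; norm_num

/-- THE COARSE OPERATOR `Q̃G₂Q̃ᵀ = (⅔)`. [folklore] -/
theorem coarse_eq : Qt * Ginv * Qtᵀ = !![(2 / 3 : ℂ)] := by
  ext i j
  fin_cases i; fin_cases j
  norm_num [Ginv, Matrix.mul_apply, Fin.sum_univ_two]

/-- Its inverse `(3∕2)`. [folklore] -/
theorem coarse_inv : (!![(2 / 3 : ℂ)] : Matrix (Fin 1) (Fin 1) ℂ)⁻¹ = !![(3 / 2 : ℂ)] := by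
  refine Matrix.inv_eq_right_inv ?_
  ext i j
  fin_cases i; fin_cases j
  norm_num [Matrix.mul_apply]

/-- The one G-piece: `G₂` itself. [folklore] -/
def G₁ : Unit → Matrix (Fin 2) (Fin 2) ℂ := fun _ => M₂⁻¹

/-- `Σ_ω G_ω = M₂⁻¹`. [folklore] -/
theorem Ktot_G₁ : Ktot G₁ = M₂⁻¹ := by simp [Ktot, G₁]

/-- THE ONE COARSE PIECE `Kp = Eᵀ(Q̃G₂Q̃ᵀ − 1)E` (`= diag(−⅓, 0)`). [folklore] -/
def Kp : Unit → Matrix (Fin 2) (Fin 2) ℂ := fun _ => (embM e₂)ᵀ * (Qt * Ktot G₁ * Qtᵀ - 1) * embM e₂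

/-- `Σ_ω Kp_ω = Eᵀ(Q̃𝒢Q̃ᵀ − 1)E` — the instance statement replacing `hdict`. [folklore] -/
theorem Ktot_Kp : Ktot Kp = (embM e₂)ᵀ * (Qt * Ktot G₁ * Qtᵀ - 1) * embM e₂ := by simp [Ktot, Kp]

/-- `Kp` explicitly: `diag(−⅓, 0)`. [folklore] -/
theorem Kp_eq : Kp () = !![-1 / 3, 0; 0, 0] := by
  rw [Kp, Ktot_G₁, M₂_inv, coarse_eq]
  ext i j
  simp only [Matrix.mul_apply, Matrix.sub_apply, Matrix.transpose_apply, Fin.sum_univ_one, embM_apply, e₂]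
  fin_cases i <;> fin_cases j <;> norm_num

/-- THE LOCAL INVERSE on the one block: `L = diag(3∕2, 1) = (1 + Kp)⁻¹`. [folklore] -/
def L₁ : Unit → Matrix (Fin 2) (Fin 2) ℂ := fun _ => !![3 / 2, 0; 0, 1]

/-- `(1 + Kp)·L = 1`. [folklore] -/
theorem one_add_Kp_mul_L : (1 + Kp ()) * L₁ () = 1 := by
  rw [Kp_eq, L₁]
  ext i j
  fin_cases i <;> fin_cases j <;> norm_num [Matrix.mul_apply, Matrix.add_apply, Fin.sum_univ_two, Matrix.one_apply]

/-- One block, partition function `h ≡ 1`. [folklore] -/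
def h₁ : Unit → Fin 2 → ℝ := fun _ _ => 1

/-- The block projection on `E b = univ` is the identity. [folklore] -/
theorem Pj_univ : Pj (fun _ : Unit => (Finset.univ : Finset (Fin 2))) () = 1 := by
  ext i j
  simp [Pj, Matrix.one_apply]

/-! ## §2 Every hypothesis of THEOREM B's identification holds on the data -/

/-- THE CONSTRAINED FAMILY of THEOREM B on the two-site data (frozen decoration `τ ≡ 1`, free cell `()`). [folklore] -/
def fam₂ : RIdx Unit (WalkΩ Unit Unit) → ℂ → Matrix (Fin 2) (Fin 2) ℂ :=
  recombTerm (decPieces G₁ (fun _ => (∅ : Finset Unit)) (fun _ => (1 : ℂ)) ())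
    (sandTerm (Qtᵀ * embM e₂) ((embM e₂)ᵀ * Qt)
      (decFamilyΩ (fun _ => ()) (fun _ => Finset.univ) (fun _ => Finset.univ) h₁ Kp (fun _ => Finset.univ) L₁
        (fun _ => (1 : ℂ)) ())) 1

/-- **JOINT SATISFIABILITY WITH A GENUINE CONSTRAINT.**  On the two-site data (`κ = 0`, `d ≡ 0`, `κ₁ = 1`, `ρ_G = 1`,
`c_P = 1`, `c_Q = 2`, `K = 1`, `a = 1`, `Dω = near = E = univ`, `M = N = 1`, `C_L = 3∕2`, `K₁ = Φ = 0`, `r = Rr = 1`,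
`D = Df = 0`, `Pk = 1`, thread `[0]`, credit `0`) EVERY hypothesis of `termSum_constrainedΩ_flucCov_embed` is discharged —
b09's nonsingularity inputs (`det M₂ = 3`, `Q̃M₂⁻¹Q̃ᵀ = ⅔`), the instance statement `Σ_ωKp_ω = Eᵀ(Q̃𝒢Q̃ᵀ − 1)E`, the
resummation data (`Σh² = 1`, `P_bL_b = L_b`, `P_b(1 + Kp)P_bL_b = P_b`), the budgets — and the family sums at `s ≡ 1` to
`flucCov 1 Q̃`. [folklore] -/
theorem termSum_fam₂ : termSum fam₂ 1 = flucCov (1 : Matrix (Fin 2) (Fin 2) ℂ) Qt := by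
  have hKa : IsUnit ((1 : Matrix (Fin 2) (Fin 2) ℂ) + (1 : ℂ) • (Qtᵀ * Qt)).det := by
    rw [one_add_eq_M₂, det_M₂]; exact isUnit_iff_ne_zero.2 (by norm_num)
  have hPr : IsUnit (Qt * ((1 : Matrix (Fin 2) (Fin 2) ℂ) + (1 : ℂ) • (Qtᵀ * Qt))⁻¹ * Qtᵀ).det := by
    rw [one_add_eq_M₂, M₂_inv, coarse_eq, Matrix.det_fin_one_of]
    exact isUnit_iff_ne_zero.2 (by norm_num)
  refine termSum_constrainedΩ_flucCov_embed (B := Unit) hw₀ (fun _ _ => rfl) G₁ (fun _ => (∅ : Finset Unit))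
    (κ₁ := 1) (ρG := 1) one_pos ?hG (embM e₂) embM_e₂ Qt (cP := 1) (cQ := 2) ?hP ?hQ 1 1 hKa hPr
    (by rw [Ktot_G₁, one_add_eq_M₂]) Kp Ktot_Kp (fun _ => Finset.univ) (fun _ _ _ _ => Finset.mem_univ _)
    (fun _ => Finset.univ) h₁ (fun _ => Finset.univ) L₁ (fun _ _ hy => (hy (Finset.mem_univ _)).elim)
    (fun _ _ => by simp [h₁]) (fun _ => by simp [h₁]) (fun _ => by rw [Pj_univ, Matrix.one_mul]) ?hloc
    (M := 1) (N := 1) (C_L := 3 / 2) (K₁ := 0) (Φ := 0) (r := 1) (D := 0) (Df := 0) (Rr := 1) one_pos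
    (fun _ _ _ => by simp [h₁, d₀]) (fun _ => by simp) (by norm_num) one_pos (by norm_num) (by norm_num) le_rfl
    (fun _ => ()) (Pk := 1) (fun _ => ⟨Finset.univ, by simp, fun _ _ => Finset.mem_univ _⟩)
    (fun _ _ _ _ _ => le_rfl) (fun _ => [0]) (fun _ z _ => ⟨0, by simp, le_rfl⟩) (fun _ => 0)
    (fun _ => by simp [listLen]) ?hL (fun _ => by simp [d₀]) (fun _ => by simp) (by norm_num) ()
  case hG =>
    -- (T3): rows of `e^{0}·‖G₂(i,j)‖·e^{0}` sum to `⅔ + ⅓ = 1`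
    intro i
    simp only [pieceMaj, G₁, M₂_inv, d₀, Finset.card_empty, Nat.cast_zero, mul_zero, Real.exp_zero, one_mul, mul_one,
      Finset.sum_const, Finset.card_univ, Fintype.card_unit, one_smul, Fin.sum_univ_two]
    fin_cases i <;> norm_num [Ginv]
  case hP =>
    refine wrs_transpose_mul_embM e₂ Qt fun y => ?_
    fin_cases y <;> simp [d₀]
  case hQ =>
    refine wrs_embM_transpose_mul e₂ (fun a b _ => Subsingleton.elim a b) Qt (by norm_num) fun a => ?_
    fin_cases a
    norm_num [d₀, Fin.sum_univ_two]
  case hloc =>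
    intro b
    have hK : Knear Kp (fun _ : Unit => (Finset.univ : Finset Unit)) b = Kp () := by simp [Knear]
    rw [Pj_univ, hK, Matrix.one_mul, Matrix.mul_one, one_add_Kp_mul_L]
  case hL =>
    intro b i
    simp only [wrs, L₁, d₀, mul_zero, Real.exp_zero, mul_one]
    fin_cases i <;> norm_num [Fin.sum_univ_two]

/-! ## §3 The value: the fluctuation covariance of the two-site block -/

/-- **`flucCov 1 Q̃ = ½[[1, −1], [−1, 1]]`** — by b09's `eq_3186_scalar` with `a = 1` and the explicit inverses:
`G₂ − G₂Q̃ᵀ(Q̃G₂Q̃ᵀ)⁻¹Q̃G₂ = ⅓[[2,−1],[−1,2]] − (3∕2)·⅑[[1,1],[1,1]]`.  It is the orthogonal projection onto the kernel of the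
averaging map (as the fluctuation covariance of `½|φ|²` under `φ₁ + φ₂ = 0` must be). [cite: Balaban1985BackgroundPropagators, (3.186) p.432] -/
theorem flucCov_two_site : flucCov (1 : Matrix (Fin 2) (Fin 2) ℂ) Qt = !![1 / 2, -1 / 2; -1 / 2, 1 / 2] := by
  have hKa : IsUnit ((1 : Matrix (Fin 2) (Fin 2) ℂ) + (1 : ℂ) • (Qtᵀ * Qt)).det := by
    rw [one_add_eq_M₂, det_M₂]; exact isUnit_iff_ne_zero.2 (by norm_num)
  have hPr : IsUnit (Qt * ((1 : Matrix (Fin 2) (Fin 2) ℂ) + (1 : ℂ) • (Qtᵀ * Qt))⁻¹ * Qtᵀ).det := by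
    rw [one_add_eq_M₂, M₂_inv, coarse_eq, Matrix.det_fin_one_of]
    exact isUnit_iff_ne_zero.2 (by norm_num)
  rw [eq_3186_scalar 1 Qt 1 hKa hPr, one_add_eq_M₂, M₂_inv, coarse_eq, coarse_inv]
  ext i j
  simp only [Matrix.sub_apply, Matrix.mul_apply, Matrix.transpose_apply, Fin.sum_univ_two, Fin.sum_univ_one, Qt_apply]
  fin_cases i <;> fin_cases j <;> norm_num [Ginv]

/-- **The chain's output on the two-site block is `½[[1, −1], [−1, 1]]`.** [folklore] -/
theorem termSum_fam₂_explicit : termSum fam₂ 1 = !![1 / 2, -1 / 2; -1 / 2, 1 / 2] := by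
  rw [termSum_fam₂, flucCov_two_site]

end

end Summit.QuantumFields.BalabanUV.Beta.AnalyticWalkSum216RowConstrainedWitness
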